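import Summits.KontsevichZagierPeriods.KontsevichZagierPeriods.Theses.HurwitzMicroSectors
import Summits.KontsevichZagierPeriods.KontsevichZagierPeriods.Theorems.HurwitzMicroSectorsNormalFormPrinciplePiBoxTransfer
import Summits.KontsevichZagierPeriods.KontsevichZagierPeriods.Theorems.HurwitzMicroSectorsNormalFormPrincipleVariants2256

/-! TTRL-lite variant V2261 of stmt-KontsevichZagierPeriods-3869

Variant V2261 = `stub_boxRigidity` (BoxRigidity: two representations on open unit boxes with integrands
of KZ's rational shape and equal values are KZ-equivalent) under the move `bound_nat:m'≤8` (the right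
dimension bounded, the left dimension `m` free). Verdict of the attempt seat: **open, and provably as
hard as the parent** — this file is the certificate, not a proof of the variant. The bound `m' ≤ 8`
contains the instance `m' = 0`, and a bounded right dimension is already the whole leaf for EVERY bound
(`boxRigidityRightLe_iff k`, file `…Variants2256`: compare with the zero representation on the `0`-box to
get BoxVanishing in every dimension, and BoxVanishing is BoxRigidity by `boxRigidity_of_boxVanishing`).
Hence `KontsevichZagierPeriods → V2261 → KZ.PiLocalKernel` (`stub_boxRigidity_var2261_of_statement`,
`piLocalKernel_of_stub_boxRigidity_var2261`): the variant sits between the Summit and Ayoub's localised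
kernel conjecture (`@[conjecture]`, open item stmt-KontsevichZagierPeriods-0541), so it is neither provable
nor refutable from the tree; with `KZ.PiCancellation` it is exactly the Summit
(`statement_iff_stub_boxRigidity_var2261_and_piCancellation`). (Contrast: the TWO-sided bound
`m, m' ≤ 1` is a theorem, `boxRigidity_of_le_one`, by Baker — only a joint bound can weaken the stub.)
Source: M. Kontsevich, D. Zagier, *Periods* (2001), §1.2 Conjecture 1; J. Ayoub, EMS Newsl. 91 (2014),
Conj. 7. Pure proof file, no definitions. -/

-- `Summit.<Summit>.<Problem>` is the tree's mandated summit-side namespace (CONVENTIONS §2); for this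
-- single-conjunct summit the two coincide, so the duplicate is deliberate.
set_option linter.dupNamespace false

noncomputable section

namespace Summit.KontsevichZagierPeriods.KontsevichZagierPeriods.Theorems

open MeasureTheory Set
open Literature.NumberTheory.Transcendental Literature.NumberTheory.Transcendental.KZ
open Summit.KontsevichZagierPeriods.KontsevichZagierPeriods.Theses.HurwitzMicroSectors
open Summit.KontsevichZagierPeriods.HurwitzMicroSectors.NormalFormPrinciple.PiBox

/-! ## The variant V2261: between the Summit and `KZ.PiLocalKernel` -/

/-- **V2261 ⟺ the parent leaf `BoxRigidity`** (instance `k = 8` of `boxRigidityRightLe_iff`).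
[cite: KontsevichZagier2001, §1.2 Conjecture 1] -/
theorem stub_boxRigidity_var2261_iff_parent :
    (∀ (m m' : ℕ) (N : IntegralRep m) (N' : IntegralRep m'), m' ≤ 8 → N.domain = {x | ∀ i, x i ∈ Set.Ioo (0:ℝ) 1} → N.IsRational → N'.domain = {x | ∀ i, x i ∈ Set.Ioo (0:ℝ) 1} → N'.IsRational → N.value = N'.value → Equivalent N N') ↔
    (∀ (m m' : ℕ) (N : IntegralRep m) (N' : IntegralRep m'), N.domain = {x | ∀ i, x i ∈ Set.Ioo (0:ℝ) 1} → N.IsRational → N'.domain = {x | ∀ i, x i ∈ Set.Ioo (0:ℝ) 1} → N'.IsRational → N.value = N'.value → Equivalent N N') :=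
  boxRigidityRightLe_iff 8

/-- **V2261 ⟺ BoxVanishing** (one representation, value `0`, any dimension): the one-representation
form of the variant, through `stub_boxRigidity_var2261_iff_parent`, `boxVanishing_of_boxRigidity` and
`boxRigidity_of_boxVanishing`. [cite: KontsevichZagier2001, §1.2 Conjecture 1] -/
theorem stub_boxRigidity_var2261_iff_boxVanishing :
    (∀ (m m' : ℕ) (N : IntegralRep m) (N' : IntegralRep m'), m' ≤ 8 → N.domain = {x | ∀ i, x i ∈ Set.Ioo (0:ℝ) 1} → N.IsRational → N'.domain = {x | ∀ i, x i ∈ Set.Ioo (0:ℝ) 1} → N'.IsRational → N.value = N'.value → Equivalent N N') ↔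
    (∀ (m : ℕ) (N : IntegralRep m), N.domain = {x | ∀ i, x i ∈ Set.Ioo (0:ℝ) 1} →
      N.IsRational → N.value = 0 → of N ∈ relations) := by
  rw [stub_boxRigidity_var2261_iff_parent]
  exact ⟨fun h m N hNd hNr hv => boxVanishing_of_boxRigidity h N hNd hNr hv,
    fun h => boxRigidity_of_boxVanishing h⟩

/-- **V2261 ⇒ `KZ.PiLocalKernel`** (Ayoub's localised kernel conjecture for this calculus — open): a
proof of the variant would settle an open conjecture of the tree. [cite: Ayoub2014, Def. 6 and Conj. 7] -/
theorem piLocalKernel_of_stub_boxRigidity_var2261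
    (h : ∀ (m m' : ℕ) (N : IntegralRep m) (N' : IntegralRep m'), m' ≤ 8 → N.domain = {x | ∀ i, x i ∈ Set.Ioo (0:ℝ) 1} → N.IsRational → N'.domain = {x | ∀ i, x i ∈ Set.Ioo (0:ℝ) 1} → N'.IsRational → N.value = N'.value → Equivalent N N') :
    PiLocalKernel :=
  piLocalKernel_of_boxRigidity (stub_boxRigidity_var2261_iff_parent.1 h)

/-- **`KontsevichZagierPeriods ⇒ V2261`**: the variant is a special case of Conjecture 1 for the
tree's calculus — a refutation of the variant would refute the Summit. [cite: KontsevichZagier2001, §1.2 Conjecture 1] -/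
theorem stub_boxRigidity_var2261_of_statement (h : _root_.KontsevichZagierPeriods) :
    ∀ (m m' : ℕ) (N : IntegralRep m) (N' : IntegralRep m'), m' ≤ 8 → N.domain = {x | ∀ i, x i ∈ Set.Ioo (0:ℝ) 1} → N.IsRational → N'.domain = {x | ∀ i, x i ∈ Set.Ioo (0:ℝ) 1} → N'.IsRational → N.value = N'.value → Equivalent N N' :=
  fun m m' N N' _ => (leaves_of_statement h).1 m m' N N'

/-- **Summit ⟺ V2261 ∧ PiCancellation** (from `statement_iff_leaves`): with `π`-cancellation the variant
is exactly what the Summit needs, no more and no less. [cite: KontsevichZagier2001, §1.2 Conjecture 1] -/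
theorem statement_iff_stub_boxRigidity_var2261_and_piCancellation :
    _root_.KontsevichZagierPeriods ↔
    ((∀ (m m' : ℕ) (N : IntegralRep m) (N' : IntegralRep m'), m' ≤ 8 → N.domain = {x | ∀ i, x i ∈ Set.Ioo (0:ℝ) 1} → N.IsRational → N'.domain = {x | ∀ i, x i ∈ Set.Ioo (0:ℝ) 1} → N'.IsRational → N.value = N'.value → Equivalent N N') ∧
      PiCancellation) := by
  rw [statement_iff_leaves, stub_boxRigidity_var2261_iff_parent]

end Summit.KontsevichZagierPeriods.KontsevichZagierPeriods.Theorems
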